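import Mathlib.LinearAlgebra.RootSystem.Base
import Mathlib.LinearAlgebra.RootSystem.Hom
import Mathlib.LinearAlgebra.RootSystem.Reduced
import Mathlib.LinearAlgebra.Matrix.SpecialLinearGroup
import Literature.NumberTheory.Automorphic.LinearAlgebraicGroups
import HarnessLib

-- provenance: harness21/H21/H21/Prelude/AutomorphicL/RootData.lean @ 8f168fa (interim HEAD d8f2665); M5 mechanical rewrite
open scoped IsMulCommutative

/-!
# Roots and (based) root data of a linear algebraic group (trunk T-AUTOMORPHIC, G25 AutomorphicL, item I2)

For a subgroup `G ≤ GL n k` and a commutative subgroup `T ≤ G` (a maximal torus in the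
applications) this file defines, following Springer, *Linear Algebraic Groups* §§7.3, 8.1 and
SGA 3 Exp. XXII, the vocabulary needed to say "the root datum of `(G, T)` is `P`", where
`P : RootPairing ι ℤ X Y` is MATHLIB's root pairing / root datum (notion `dual_group_L_group`,
OUTLINE D1/I2):

* `unipotentUpperSL2`, `unipotentLowerSL2 : Multiplicative R →* SL(2, R)` and
  `diagSL2 : Rˣ →* SL(2, R)`, the standard one-parameter subgroups of `SL₂` (real definitions);
* `IsRootHom G T hTG α u`: `u : 𝔾ₐ → G` is a *root homomorphism* for the character `α` of `T`
  (algebraic, an isomorphism onto a closed subgroup, `t u(x) t⁻¹ = u(α(t) x)`; Springer 8.1.1);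
* `roots G T : Set ↥(characterLattice T)`, `rootSubgroup G T α` (the root subgroup `U_α`);
* `IsAlgebraicSL2Hom φ` for `φ : SL(2, k) →* ↥G`;
* `IsRootDatumOf G T P eX eY`: via group isomorphisms `eX : X*(T) ≃ X`, `eY : X_*(T) ≃ Y` the
  pairing of `P` is `charPairingInt`, the roots of `P` are the roots of `(G, T)`, and each coroot
  is realised by an algebraic `φ : SL₂ → G` (Springer 7.3.3–7.3.5, 8.1.8, 7.4.3);
* `IsBasedRootDatumOf G B T P b eX eY`: moreover `B ⊇ T` is a Borel subgroup containing the
  simple root subgroups of the base `b : P.Base` (Springer 7.4.5–7.4.6, 8.2.4);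
* `Pinning G T hTG P b eX`: a choice of root homomorphisms for the simple roots (SGA 3 XXIII 1.1,
  "épinglage");
* `RootPairing.Equiv.IsBased e b` (an automorphism of `P` permutes the simple roots of `b`) and
  the subgroup `basedAutGroup P b ≤ P.Aut` of based automorphisms (SGA 3 XXI 6.1, XXIV 3).

Theorems (proofs `sorry`, all in print): `roots_finite`, `rootSubgroup_unique` (Springer 8.1.1),
`isReduced_of_isRootDatumOf` (Springer 7.4.3–7.4.4: root data of reductive groups are reduced).

## Mathlib

Everything about abstract root data is Mathlib's: `RootPairing` (with `root`, `coroot`,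
`toLinearMap`, `pairing`, `reflectionPerm`), `RootPairing.Base`, `RootPairing.IsReduced`,
`RootPairing.Hom/Equiv/Aut` (with `RootPairing.Equiv.indexHom`), and `RootPairing.weylGroup`
(in `Mathlib.LinearAlgebra.RootSystem.WeylGroup`, not imported here since nothing below uses
it). In particular the **dual (based) root datum** of `(P, b)` is Mathlib's `P.flip`, `b.flip`
(`RootPairing.flip`, `RootPairing.Base.flip`); we do NOT redefine it (SGA 3 XXII 1.13 / XXI 6.2;
Springer 7.4.3; Borel, *Automorphic L-functions*, §2). Mathlib has `Matrix.SpecialLinearGroup`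
with the notation `SL(2, R)` (scope `MatrixGroups`) and `ModularGroup.T = !![1,1;0,1]` over `ℤ`,
but no one-parameter subgroups `𝔾ₐ → SL₂`, `𝔾ₘ → SL₂` over a general ring (searched
`unipotent`, `SpecialLinearGroup.*diag`, `oneParam`), and no roots *of an algebraic group*.
`RootPairing.Equiv.IsBased` is a deliberate dot-notation extension in Mathlib's namespace
`RootPairing.Equiv`; all other declarations are in `Literature.Automorphic`.

## Design notes

* Roots are defined through root homomorphisms `𝔾ₐ → G` normalised by `T` (Springer 8.1.1)
  rather than through weights on a Lie algebra, so no tangent spaces of algebraic groups are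
  needed (OUTLINE D1). As in item I1 this `k`-points vocabulary is the textbook notion only for
  `k` algebraically closed; all consumers assume `[IsAlgClosed k]` or `k = ℂ`.
* Springer 8.1.1 asks `u_α` to be an *isomorphism* of `𝔾ₐ` onto a closed subgroup, not merely
  an injective morphism: in characteristic `p` the Frobenius twist `x ↦ u_α (x ^ p)` is
  injective and algebraic with character `α / p` whenever `p ∣ α` in `X*(T)` (e.g. `SL₂` in
  characteristic `2`), which would produce non-reduced "root data". `IsRootHom` therefore
  demands a polynomial retraction `q` on matrix coordinates with `q (u x) = x`.
* `IsRootDatumOf` records `T ≤ G` as a field `le`; maximality of `T` and reductivity of `G` are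
  separate hypotheses of the statements consuming it (lang.S13).

## References

* T. A. Springer, *Linear Algebraic Groups* (2nd ed., 1998), §§7.3, 7.4, 8.1, 8.2, 9.6, 16.3.
* M. Demazure, A. Grothendieck, *SGA 3*, Exp. XXI (données radicielles), XXII, XXIII 1, XXIV 3.
* A. Borel, *Automorphic L-functions*, Corvallis 1979, §§1–2.
-/

open scoped MatrixGroups

namespace Literature.NumberTheory.Automorphic

/-! ### One-parameter subgroups of `SL₂` -/

section SL2

variable {R : Type*} [CommRing R]

/-- The upper unipotent one-parameter subgroup `x ↦ [[1, x], [0, 1]]` of `SL₂`, as a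
homomorphism `𝔾ₐ → SL(2, R)` (Springer 7.2.2, 8.1.1). [folklore] -/
def unipotentUpperSL2 : Multiplicative R →* SL(2, R) where
  toFun x := ⟨!![1, x.toAdd; 0, 1], by simp [Matrix.det_fin_two_of]⟩
  map_one' := Subtype.ext <| by simp [Matrix.one_fin_two]
  map_mul' x y := Subtype.ext <| by
    simp only [Matrix.SpecialLinearGroup.coe_mul, Matrix.mul_fin_two, toAdd_mul]
    simp [add_comm]

/-- The matrix of `unipotentUpperSL2 x`. [folklore] -/
@[simp] lemma coe_unipotentUpperSL2 (x : Multiplicative R) :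
    ((unipotentUpperSL2 x : SL(2, R)) : Matrix (Fin 2) (Fin 2) R) = !![1, x.toAdd; 0, 1] := rfl

/-- The lower unipotent one-parameter subgroup `x ↦ [[1, 0], [x, 1]]` of `SL₂`, as a
homomorphism `𝔾ₐ → SL(2, R)` (Springer 7.2.2, 8.1.1). [folklore] -/
def unipotentLowerSL2 : Multiplicative R →* SL(2, R) where
  toFun x := ⟨!![1, 0; x.toAdd, 1], by simp [Matrix.det_fin_two_of]⟩
  map_one' := Subtype.ext <| by simp [Matrix.one_fin_two]
  map_mul' x y := Subtype.ext <| by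
    simp only [Matrix.SpecialLinearGroup.coe_mul, Matrix.mul_fin_two, toAdd_mul]
    simp [add_comm]

/-- The matrix of `unipotentLowerSL2 x`. [folklore] -/
@[simp] lemma coe_unipotentLowerSL2 (x : Multiplicative R) :
    ((unipotentLowerSL2 x : SL(2, R)) : Matrix (Fin 2) (Fin 2) R) = !![1, 0; x.toAdd, 1] := rfl

/-- The diagonal torus `t ↦ [[t, 0], [0, t⁻¹]]` of `SL₂`, as a homomorphism `𝔾ₘ → SL(2, R)`;
this is the coroot of the positive root of `SL₂` (Springer 7.2.2, 7.4.1). [folklore] -/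
def diagSL2 : Rˣ →* SL(2, R) where
  toFun t := ⟨!![(t : R), 0; 0, ((t⁻¹ : Rˣ) : R)], by simp [Matrix.det_fin_two_of]⟩
  map_one' := Subtype.ext <| by simp [Matrix.one_fin_two]
  map_mul' s t := Subtype.ext <| by
    simp only [Matrix.SpecialLinearGroup.coe_mul, Matrix.mul_fin_two, mul_inv, Units.val_mul]
    simp [mul_comm]

/-- The matrix of `diagSL2 t`. [folklore] -/
@[simp] lemma coe_diagSL2 (t : Rˣ) :
    ((diagSL2 t : SL(2, R)) : Matrix (Fin 2) (Fin 2) R) = !![(t : R), 0; 0, ((t⁻¹ : Rˣ) : R)] :=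
  rfl

end SL2

variable {k : Type*} [Field k] {n : Type*} [Fintype n] [DecidableEq n]

/-! ### Root homomorphisms, roots and root subgroups -/

section Roots

variable (G T : Subgroup (GL n k))

/-- `u : 𝔾ₐ → G` is a *root homomorphism* of `G` relative to `T ≤ G` with character
`α : T → 𝔾ₘ`: `u` is an algebraic homomorphism which is an *isomorphism onto a closed
subgroup* — expressed by the existence of a polynomial `q` in the matrix coordinates with
`q (u x) = x`, i.e. a regular retraction (this forces injectivity and, in characteristic `p`,
excludes Frobenius twists `x ↦ u (x ^ p)`) — such that `t · u(x) · t⁻¹ = u(α(t) x)` for all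
`t ∈ T`, `x ∈ k` (Springer 8.1.1 (i)). [folklore] -/
def IsRootHom (hTG : T ≤ G) (α : ↥T →* kˣ) (u : Multiplicative k →* ↥G) : Prop :=
  IsAlgebraicAddHom u ∧
    (∃ q : MvPolynomial (GLCoord n) k, ∀ x : k,
      MvPolynomial.eval (glCoordFun ((u (Multiplicative.ofAdd x) : ↥G) : GL n k)) q = x) ∧
    ∀ (t : ↥T) (x : k),
      Subgroup.inclusion hTG t * u (Multiplicative.ofAdd x) * (Subgroup.inclusion hTG t)⁻¹ =
        u (Multiplicative.ofAdd ((α t : k) * x))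

/-- The set of *roots* of `G` relative to `T`: the non-trivial algebraic characters `α ∈ X*(T)`
admitting a root homomorphism (Springer 8.1.1, 7.4.3; for `G` connected reductive and `T` a
maximal torus over an algebraically closed field these are exactly the non-zero weights of `T`
on the Lie algebra of `G`, Springer 8.1.1, 8.1.3; the isomorphism-onto-image clause of
`IsRootHom` is what makes this true in positive characteristic as well). The existential over
the proof `hTG : T ≤ G` makes this `∅` when `T ≰ G` (junk value). [folklore] -/
def roots : Set ↥(characterLattice T) :=
  {α | (α : ↥T →* kˣ) ≠ 1 ∧ ∃ hTG : T ≤ G, ∃ u : Multiplicative k →* ↥G, IsRootHom G T hTG α u}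

/-- The *root subgroup* `U_α ≤ G` attached to a character `α` of `T`: the subgroup of `GL n k`
generated by the images of all root homomorphisms for `α`. For `G` connected reductive, `T` a
maximal torus and `α` a root this is the image of any single root homomorphism
(`rootSubgroup_unique`; Springer 8.1.1: `U_α` is the unique closed connected subgroup
normalised by `T` with Lie algebra `𝔤_α`). It is `⊥` if `α` is not a root or if `T ≰ G`
(junk values). [folklore] -/
def rootSubgroup (α : ↥T →* kˣ) : Subgroup (GL n k) :=
  ⨆ (hTG : T ≤ G) (u : Multiplicative k →* ↥G) (_ : IsRootHom G T hTG α u), u.range.map G.subtype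

variable {G T}

/-- The set of roots of a connected reductive group relative to a maximal torus is finite
(Springer 7.4.3, 8.1.1: it is the root system of a root datum; over an algebraically closed
field). [cite: SpringerLAG1998, 7.4.3 and 8.1.1] -/
def roots_finite : Prop :=
  ∀ [IsAlgClosed k] (hG : IsConnectedReductive G) (hT : IsMaximalTorusIn T G),
    (roots G T).Finite

/-- Uniqueness of root subgroups: for `G` connected reductive over an algebraically closed field,
`T` a maximal torus and `α` a root, the image of *any* root homomorphism for `α` is the root
subgroup `U_α` (Springer 8.1.1 (i): `u_α` is unique up to `x ↦ u_α (c x)`, `c ∈ kˣ`). [cite: SpringerLAG1998, 8.1.1 (i)] -/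
def rootSubgroup_unique : Prop :=
  ∀ [IsAlgClosed k] (hG : IsConnectedReductive G) (hT : IsMaximalTorusIn T G) {α : ↥(characterLattice T)} (hα : α ∈ roots G T) {u : Multiplicative k →* ↥G} (hu : IsRootHom G T hT.1 α u),
    u.range.map G.subtype = rootSubgroup G T α

end Roots

/-! ### Root data of `(G, T)` -/

section RootDatum

/-- A homomorphism `φ : SL(2, k) → G ≤ GL n k` is *algebraic* if every coordinate of `φ g` is a
polynomial in the four entries of `g` (Springer 2.1.1, 2.2.1). [folklore] -/
def IsAlgebraicSL2Hom {G : Subgroup (GL n k)} (φ : SL(2, k) →* ↥G) : Prop :=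
  ∃ P : GLCoord n → MvPolynomial (Fin 2 × Fin 2) k,
    ∀ (g : SL(2, k)) (c : GLCoord n),
      glCoordFun ((φ g : ↥G) : GL n k) c =
        MvPolynomial.eval (fun ij => (g : Matrix (Fin 2) (Fin 2) k) ij.1 ij.2) (P c)

variable {ι X Y : Type*} [AddCommGroup X] [AddCommGroup Y]
variable (G T : Subgroup (GL n k))

variable {T} in
/-- The character `χ : T → 𝔾ₘ` corresponding to a weight `x : X` under an identification
`eX : X*(T) ≃ X` (auxiliary; Springer 7.4.3). [folklore] -/
def charOfWeight (eX : Additive ↥(characterLattice T) ≃+ X) (x : X) : ↥T →* kˣ :=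
  (Additive.toMul (eX.symm x)).1

variable [IsMulCommutative ↥T]

variable {T} in
/-- The cocharacter `λ : 𝔾ₘ → T` corresponding to a coweight `y : Y` under an identification
`eY : X_*(T) ≃ Y` (auxiliary; Springer 7.4.3). [folklore] -/
def cocharOfCoweight (eY : Additive ↥(cocharacterLattice T) ≃+ Y) (y : Y) : kˣ →* ↥T :=
  (Additive.toMul (eY.symm y)).1

/-- `P : RootPairing ι ℤ X Y` *is the root datum of* `(G, T)` via the identifications
`eX : X*(T) ≃ X` of the character lattice with the weight lattice and `eY : X_*(T) ≃ Y` of the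
cocharacter lattice with the coweight lattice (Springer 7.4.3, 3.2.11, 8.1.8; SGA 3 XXII 1.14):

* `le`: `T ≤ G`;
* `pairing_eq`: the perfect pairing of `P` is the pairing `⟨χ, λ⟩` with `χ (λ x) = x ^ ⟨χ, λ⟩`
  (`charPairingInt`);
* `range_root`: the roots of `P` are exactly (the images of) the roots of `(G, T)`;
* `exists_sl2Hom`: for every `i : ι`, writing `α = eX⁻¹ (P.root i)` and `α^∨ = eY⁻¹ (P.coroot i)`,
  there is an algebraic homomorphism `φ : SL₂ → G` whose restrictions to the upper and lower
  unipotent subgroups are root homomorphisms for `α` and `-α` and whose restriction to the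
  diagonal torus is the cocharacter `α^∨` (Springer 7.3.3–7.3.5 with 8.1.8: this characterises
  the coroot `α^∨ ∈ X_*(T)`).

The dual root datum is then `P.flip` (Mathlib `RootPairing.flip`). [folklore] -/
structure IsRootDatumOf (P : RootPairing ι ℤ X Y) (eX : Additive ↥(characterLattice T) ≃+ X)
    (eY : Additive ↥(cocharacterLattice T) ≃+ Y) : Prop where
  /-- The torus is contained in the group. -/
  le : T ≤ G
  /-- The pairing of `P` is the character–cocharacter pairing (Springer 3.2.11). -/
  pairing_eq : ∀ (χ : ↥(characterLattice T)) (γ : ↥(cocharacterLattice T)),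
    P.toLinearMap (eX (Additive.ofMul χ)) (eY (Additive.ofMul γ)) =
      charPairingInt (χ : ↥T →* kˣ) (γ : kˣ →* ↥T)
  /-- The roots of `P` are the roots of `(G, T)` (Springer 7.4.3). -/
  range_root : Set.range P.root = (fun α => eX (Additive.ofMul α)) '' roots G T
  /-- Each root/coroot pair comes from an algebraic `SL₂ → G` (Springer 7.3.3–7.3.5, 8.1.8). -/
  exists_sl2Hom : ∀ i : ι, ∃ φ : SL(2, k) →* ↥G, IsAlgebraicSL2Hom φ ∧
    IsRootHom G T le (charOfWeight eX (P.root i))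
      (φ.comp unipotentUpperSL2) ∧
    IsRootHom G T le (charOfWeight eX (P.root i))⁻¹
      (φ.comp unipotentLowerSL2) ∧
    ∀ t : kˣ, φ (diagSL2 t) =
      Subgroup.inclusion le (cocharOfCoweight eY (P.coroot i) t)

/-- `(P, b)` *is the based root datum of* the triple `(G, B, T)`: `P` is the root datum of
`(G, T)`, `B` is a Borel subgroup of `G` containing `T`, and the root subgroups `U_α` of the
simple roots `α` of the base `b` are contained in `B`; equivalently `B` is the Borel subgroup
`T · ∏_{α > 0} U_α` attached to the positive system defined by `b` (Springer 7.4.5–7.4.6, 8.2.4;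
SGA 3 XXII 5.5). The dual based root datum is `(P.flip, b.flip)` (Mathlib `RootPairing.flip`,
`RootPairing.Base.flip`). [folklore] -/
structure IsBasedRootDatumOf (B : Subgroup (GL n k)) (P : RootPairing ι ℤ X Y) (b : P.Base)
    (eX : Additive ↥(characterLattice T) ≃+ X) (eY : Additive ↥(cocharacterLattice T) ≃+ Y) :
    Prop where
  /-- `P` is the root datum of `(G, T)`. -/
  isRootDatumOf : IsRootDatumOf G T P eX eY
  /-- `B` is a Borel subgroup of `G`. -/
  isBorelIn : IsBorelIn B G
  /-- `T ≤ B`. -/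
  torus_le : T ≤ B
  /-- The simple root subgroups lie in `B`. -/
  rootSubgroup_le : ∀ i ∈ b.support,
    rootSubgroup G T (charOfWeight eX (P.root i)) ≤ B

/-- A *pinning* (épinglage) of `(G, T)` with respect to the base `b` of its root datum `P`: a
choice, for every simple root `α`, of a root homomorphism `u_α : 𝔾ₐ → G` (equivalently of a
non-zero root vector `X_α ∈ 𝔤_α`; SGA 3 XXIII 1.1, XXIV 1; Springer 8.1.1, 9.6.1;
Borel, *Automorphic L-functions* §1.2 (splitting)). The inclusion `hTG : T ≤ G` is a
parameter (in applications `h.le` for `h : IsRootDatumOf G T P eX eY`). [folklore] -/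
structure Pinning (hTG : T ≤ G) (P : RootPairing ι ℤ X Y) (b : P.Base)
    (eX : Additive ↥(characterLattice T) ≃+ X) where
  /-- The chosen root homomorphism of each simple root. -/
  rootHom : ↥b.support → (Multiplicative k →* ↥G)
  /-- Each chosen homomorphism is a root homomorphism for the corresponding simple root. -/
  isRootHom : ∀ i : ↥b.support,
    IsRootHom G T hTG (charOfWeight eX (P.root (i : ι))) (rootHom i)

variable {G T}

/-- The root datum of a connected reductive group relative to a maximal torus over an
algebraically closed field is *reduced*: proportional roots are equal or opposite
(Springer 7.4.3–7.4.4, 7.1.6; Mathlib `RootPairing.IsReduced`). [cite: SpringerLAG1998, 7.4.3–7.4.4 and 7.1.6] -/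
def isReduced_of_isRootDatumOf : Prop :=
  ∀ [IsAlgClosed k] (hG : IsConnectedReductive G) (hT : IsMaximalTorusIn T G) {P : RootPairing ι ℤ X Y} {eX : Additive ↥(characterLattice T) ≃+ X} {eY : Additive ↥(cocharacterLattice T) ≃+ Y} (h : IsRootDatumOf G T P eX eY),
    P.IsReduced

end RootDatum

end Literature.NumberTheory.Automorphic

/-! ### Based automorphisms of a root datum -/

namespace RootPairing.Equiv

variable {ι R M N : Type*} [CommRing R] [AddCommGroup M] [Module R M] [AddCommGroup N]
  [Module R N] {P : RootPairing ι R M N}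

/-- An automorphism `e` of a root pairing `P` is *based* with respect to the base `b` if its
permutation of the roots preserves the set of simple roots of `b` (SGA 3 XXI 6.1, XXIV 3.1: the
group `Aut(P, Δ)` of automorphisms of a based root datum; Borel, *Automorphic L-functions* §1.2).
Deliberate dot-notation extension of Mathlib's `RootPairing.Equiv`. [folklore] -/
def IsBased (e : P.Aut) (b : P.Base) : Prop :=
  ∀ i : ι, RootPairing.Equiv.indexHom P e i ∈ b.support ↔ i ∈ b.support

end RootPairing.Equiv

namespace Literature.NumberTheory.Automorphic

variable {ι R M N : Type*} [CommRing R] [AddCommGroup M] [Module R M] [AddCommGroup N]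
  [Module R N]

/-- The group `Aut(P, b)` of *based automorphisms* of the root pairing `P` with base `b`: the
automorphisms of `P` whose root permutation preserves the simple roots of `b`, as a subgroup of
Mathlib's `P.Aut` (SGA 3 XXI 6.1, XXIV 3.1; for a based root datum
`Aut P = W ⋊ Aut(P, b)`, SGA 3 XXI 6.7). The Galois action on the based root datum of the dual
group (item DualGroup) takes values in this subgroup. Equivalently this is
`(MulAction.stabilizer (ι ≃ ι) b.support).comap (RootPairing.Equiv.indexHom P)` for the
pointwise action on `Finset ι`; the direct description is kept for ease of use. [folklore] -/
def basedAutGroup (P : RootPairing ι R M N) (b : P.Base) : Subgroup P.Aut where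
  carrier := {e | e.IsBased b}
  one_mem' i := by simp
  mul_mem' {e f} he hf i := by
    rw [map_mul, Equiv.Perm.mul_apply, he, hf]
  inv_mem' {e} he i := by
    rw [map_inv, ← he (((RootPairing.Equiv.indexHom P) e)⁻¹ i), Equiv.Perm.inv_def,
      Equiv.apply_symm_apply]

/-- Membership in `basedAutGroup P b` (SGA 3 XXI 6.1). [folklore] -/
@[simp] lemma mem_basedAutGroup_iff {P : RootPairing ι R M N} {b : P.Base} (e : P.Aut) :
    e ∈ basedAutGroup P b ↔ e.IsBased b := Iff.rfl

end Literature.NumberTheory.Automorphic
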